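import Summits.NavierStokesRegularity.NavierStokesRegularity.Theorems.PalasekTowerBreakdownEpisodeBaseTMechanismFreeRun
import Literature.Analysis.FluidPDE.AxisymmetricEuler

/-!
# Line `arnold_ring_door` — EpisodeBaseT (stmt-NavierStokesRegularity-20303) through a door in ARNOLD CURRENCY
# for explicit Gaussian-cored coaxial vortex rings WITH SWIRL (design stub ⊕ uniform viscous-coherence stub)

Seat `ns-idea-12` g0 (D-0145 ideator, lens «oqh» = open-question harvest), 2026-08-28. Crux of record:
`Theses.PalasekTowerBreakdown.EpisodeBaseT = EpisodeBaseGAt TowerRates.tuned` (route `PalasekTowerBreakdown` rev 19,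
deciding binder h₁ of `closes`; DORMANT-REVIEW «KERNEL-INFEASIBLE (present means)»). WHAT THIS IS NOT: not Navier–Stokes
evidence — no run, design or certificate is exhibited; `EpisodeBaseT` appears only as the conclusion of the sorry-free
composition `episodeBaseT_from_line` of the two registered stubs. No summit is proved by a line.
REVISION v4 (2026-08-28 04:2xZ, before any decider job ran): the residual budget of `ResidualSmall` is re-scaled from
«per window» to «per enhanced-dissipation time `M₀/A₀`» (§0, §1) — v1–v3's budget made stub 1 dead by design; the strength
moved into stub 2 is the saturation mechanism Gallay–Šverák conjecture (p. 4). Statements of both stubs changed by exactly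
this constant; the composition is untouched.

## The cut

Every registered line of this crux (`straindoor`, `doormirror`, `robustmirror`, `birth`) ends in ONE computation stub: a
validated free Navier–Stokes run (3-D `RawCertificateAt tuned`, kernel price `10^19·(E₀+G₂w₀)·e^{∫Γ} ≤ 1/4`, p532337; or the
2-D sterile door box, which converts the route by K201). The STRATEGY-CENSUS (cstrat g3) records «no analytic inhabitant
known ×3» and names the asymptotic regime S⁺₂ as the only place where analysis could replace computation, objecting that
(a) the needed multi-ring sup-norm coherence over `O(10²)` strain times is absent from print and (b) the sterile version
converts the route. This line types S⁺₂ OUTSIDE the sterile class and splits it at the seam the certificate road also has —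
DESIGN+ACCURACY versus STABILITY — but changes the currency of the stability half:

* `SwirlRingDesignT` (stub 1, finite-dimensional, decidable by quadrature this week): an EXPLICIT reference flow — a
  superposition of `n` Gaussian-cored coaxial vortex rings with prescribed radius / height / core / swirl trajectories
  `(R_i, Z_i, a_i, s_i)(t)` on the tuned window, velocity = Biot–Savart of the explicit azimuthal vorticity + the explicit
  azimuthal swirl field — lies in the thin-ring regime (`a_i ≤ R_i/20`, disjoint cores, a swirl floor of 5 % of the core
  speed on some ring: NOT axisymmetric-swirl-free), meets the four tuned door faces and the cap with RELATIVE SLACK `θ`, has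
  datum speed `≤ (1−θ)·Y₀`, and solves Navier–Stokes on the window up to a residual force of sup size `≤ θ·Y₁·A₀/M₀`
  (v4: a velocity error `θ·Y₁` per enhanced-dissipation time `M₀/A₀`, `M₀ = Re₀^{1/3} ≈ 9.19` level-`0` strain times;
  v1–v3 divided by the whole window `τ₁ − 1 ≈ 169.85/A₀`, which no closed-form ansatz can meet — see `ResidualSmall`).
* `ArnoldRingDoorT` (stub 2, the analysis; XL, research-grade = the open question in print): UNIFORMLY over such
  configurations, near the reference datum (within `θ·Y₀/2` in sup norm) there is a smooth compactly supported
  divergence-free AXISYMMETRIC datum WITH SWIRL whose free run exists classically with finite energy on the tuned window and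
  meets the door box with some margin `η > 0` — i.e. viscous multi-ring coherence with SATURATING accumulation of the
  residual at the shear-diffusion scale (no `e^{∫Γ}` Grönwall fee, and no linear pile-up over the ≈ 18 dissipation times of
  the window either), the several-rings / long-window extension of Gallay–Šverák's one-ring theorem that
  the authors leave open: arXiv:2301.01092 p. 4 («We conjecture that an approximation result of the form (nseapp) remains
  valid on longer time scales of order T_adv·Re^{σ′} … but we have no proof so far») and p. 6 («our result is restricted to
  a single vortex ring … One needs to show that the solutions will stay "coherent" for a sufficiently long time and the
  viscous effects will not be enhanced too much by the high velocities inside and near the ring»).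
* `episodeBaseT_from_line : EpisodeBaseT` — the sorry-free composition `SwirlRingDesignT → ArnoldRingDoorT → EpisodeBaseT`
  (pure logic + the landed binder-form door `Theorems.palasekTowerBreakdown_episodeBaseT_of_mechanism_freeRun`, p540639)
  applied to the two stubs; it is the ONLY theorem of the file concluding the crux (what `ledger skeleton check` audits).

References: T. Gallay, V. Šverák, arXiv:2301.01092 (Inventiones 2024), Thm 1.1, pp. 4, 6–7; T. Gallay, ARMA 200 (2011)
445–490 (planar viscous point-vortex shadowing); T. Gallay, C. E. Wayne, CMP 255 (2005) (Lamb–Oseen stability, all Re);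
J. Dávila, M. del Pino, M. Musso, J. Wei, arXiv:2207.07428 (inviscid leapfrogging); S. Palasek, arXiv:2605.13827 §4
[cite: Palasek2026ElementaryModel, §4]; [cite: KNSS2009, §1].
-/

noncomputable section

-- `Summit.<Summit>.<Problem>`: single-conjunct summit, the duplicate namespace is the tree's convention.
set_option linter.dupNamespace false

namespace Summit.NavierStokesRegularity.NavierStokesRegularity.Cruxes.EpisodeBaseT.ArnoldRingDoor

open Set MeasureTheory Filter Topology Function Metric
open scoped ENNReal ContDiff NNReal
open Literature.Analysis.FluidPDE
open Summit.NavierStokesRegularity.FluidComputer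
open Summit.NavierStokesRegularity.FluidComputer.PalasekTowerClayBridge
open Summit.NavierStokesRegularity.NavierStokesRegularity.Theses

/-! ## §0 The tuned numbers (abbreviations only) -/

/-- Right end of the tuned window `[1, τfirstAt tuned]`. -/
abbrev τ1 : ℝ := Host.τfirstAt TowerRates.tuned
/-- Datum speed bound `Y₀(tuned)`. -/
abbrev Y0 : ℝ := TowerRates.tuned.Y 0
/-- Level-`1` speed face `Y₁(tuned)`. -/
abbrev Y1 : ℝ := TowerRates.tuned.Y 1
/-- Level-`1` gradient face `A₁(tuned)`. -/
abbrev A1 : ℝ := TowerRates.tuned.A 1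
/-- Level-`1` frequency `N₁(tuned)`. -/
abbrev N1 : ℝ := TowerRates.tuned.N 1
/-- Amplitude exponent `β` of the tuned register. -/
abbrev βt : ℝ := TowerRates.tuned.β
/-- Level-`0` strain rate `A₀(tuned) = N₀^β = 2^{288/5}` (inverse level-`0` strain time). -/
abbrev A0 : ℝ := TowerRates.tuned.A 0
/-- The enhanced-dissipation number of the level-`0` core, `M₀ = Re₀^{1/3} = N₀^{(β−2)/3} = 2^{16/5} ≈ 9.19` (`Re₀ = N₀^{β−2}`
= circulation/viscosity scale of level `0`): the shear-diffusion (Rhines–Young / Bernoff–Lingevitch / Gallay) time of a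
Gaussian core is `Re^{1/3}` turnover times; `M₀/A₀` is that time at level `0`. [v4] -/
abbrev M0 : ℝ := TowerRates.tuned.N 0 ^ ((TowerRates.tuned.β - 2) / 3)

/-! ## §1 The explicit reference class: Gaussian-cored coaxial rings with swirl -/

/-- A coaxial `n`-ring configuration on the tuned window: signed circulations `Γ i`, and for each ring the radius,
height, Gaussian core radius and peak swirl speed as functions of time; `ρ₀` bounds the region the rings occupy. -/
structure RingConfig where
  /-- number of rings -/
  n : ℕ
  /-- signed circulation of ring `i` (time-independent) -/
  Γ : Fin n → ℝ
  /-- ring radius trajectory -/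
  R : Fin n → ℝ → ℝ
  /-- ring height (axial position) trajectory -/
  Z : Fin n → ℝ → ℝ
  /-- Gaussian core radius trajectory -/
  a : Fin n → ℝ → ℝ
  /-- peak azimuthal (swirl) speed trajectory of ring `i` -/
  s : Fin n → ℝ → ℝ
  /-- radius of the ball containing the rings (with room) -/
  ρ₀ : ℝ

/-- Squared distance to the symmetry axis (`x₃`-axis): `ϖ² = y₀² + y₁²` (a polynomial, smooth). -/
def cylSq (y : EuclideanSpace ℝ (Fin 3)) : ℝ := y 0 ^ 2 + y 1 ^ 2

/-- `ϖ · e_θ = (−y₁, y₀, 0)` — the azimuthal direction times the axial distance (smooth, vanishes on the axis). -/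
def azim (y : EuclideanSpace ℝ (Fin 3)) : EuclideanSpace ℝ (Fin 3) :=
  y 0 • EuclideanSpace.single 1 (1 : ℝ) - y 1 • EuclideanSpace.single 0 (1 : ℝ)

/-- The smooth Gaussian ring profile of ring `i` at time `t`: `exp(−(ϖ² − R²)²/(4R²a²) − (y₂ − Z)²/a²)` — near the core
circle `(ϖ²−R²)/(2R) ≈ ϖ − R`, so this is the Gaussian of width `a` around the circle of radius `R` at height `Z`, written as
a smooth function of `y` (polynomial in `ϖ²`). -/
def gauss (c : RingConfig) (i : Fin c.n) (t : ℝ) (y : EuclideanSpace ℝ (Fin 3)) : ℝ :=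
  Real.exp (-((cylSq y - c.R i t ^ 2) ^ 2 / (4 * c.R i t ^ 2 * c.a i t ^ 2)) - (y 2 - c.Z i t) ^ 2 / c.a i t ^ 2)

/-- Reference azimuthal VORTICITY: `ω_ref(t, y) = Σ_i Γ_i/(π a_i² R_i) · gauss_i(t, y) · (ϖ e_θ)` (so `ω_θ ≈ Γ_i/(π a_i²)·Gaussian`
near core `i`: circulation `≈ Γ_i`). Smooth and axisymmetric by construction. -/
def ωRef (c : RingConfig) (t : ℝ) (y : EuclideanSpace ℝ (Fin 3)) : EuclideanSpace ℝ (Fin 3) :=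
  ∑ i : Fin c.n, (c.Γ i / (Real.pi * c.a i t ^ 2 * c.R i t) * gauss c i t y) • azim y

/-- The Biot–Savart velocity of a vorticity field: `(1/4π) ∫ ω(y) × (x − y)/‖x − y‖³ dy`. -/
def biotSavart (ζ : EuclideanSpace ℝ (Fin 3) → EuclideanSpace ℝ (Fin 3)) (x : EuclideanSpace ℝ (Fin 3)) :
    EuclideanSpace ℝ (Fin 3) :=
  (1 / (4 * Real.pi)) • ∫ y, (‖x - y‖ ^ 3)⁻¹ • cross (ζ y) (x - y)

/-- Reference azimuthal SWIRL velocity: `Σ_i (s_i/R_i) · gauss_i · (ϖ e_θ)` (peak `≈ s_i` on core `i`). -/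
def swirlRef (c : RingConfig) (t : ℝ) (y : EuclideanSpace ℝ (Fin 3)) : EuclideanSpace ℝ (Fin 3) :=
  ∑ i : Fin c.n, (c.s i t / c.R i t * gauss c i t y) • azim y

/-- The explicit reference VELOCITY: poloidal part = Biot–Savart of `ωRef`, azimuthal part = `swirlRef`. -/
def wRef (c : RingConfig) (t : ℝ) (x : EuclideanSpace ℝ (Fin 3)) : EuclideanSpace ℝ (Fin 3) :=
  biotSavart (ωRef c t) x + swirlRef c t x

/-- THE THIN-RING REGIME on the tuned window (explicit numerals): at least one ring; positive cores with `a_i ≤ R_i/20`;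
rings inside `‖x‖ ≤ ρ₀/2` with ten core radii to spare; pairwise meridional core separation `≥ 2(a_i + a_j)` (no core
overlap); and a SWIRL FLOOR on some ring: `|s_i| ≥ |Γ_i|/(40π a_i)` (5 % of the core-edge speed `Γ/(2πa)`) throughout — the
witness class is NOT the sterile axisymmetric-swirl-free one. -/
def Regime (c : RingConfig) : Prop :=
  1 ≤ c.n ∧ 0 ≤ c.ρ₀ ∧
  (∀ t ∈ Icc (1 : ℝ) τ1, ∀ i : Fin c.n,
      0 < c.a i t ∧ c.a i t ≤ c.R i t / 20 ∧ c.R i t + |c.Z i t| + 10 * c.a i t ≤ c.ρ₀ / 2 ∧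
      ∀ j : Fin c.n, j ≠ i →
        2 * (c.a i t + c.a j t) ≤ Real.sqrt ((c.R i t - c.R j t) ^ 2 + (c.Z i t - c.Z j t) ^ 2)) ∧
  (∃ i : Fin c.n, c.Γ i ≠ 0 ∧ ∀ t ∈ Icc (1 : ℝ) τ1, |c.Γ i| / (40 * Real.pi * c.a i t) ≤ |c.s i t|)

/-- THE TUNED DOOR FACES FOR THE REFERENCE FLOW WITH RELATIVE SLACK `θ`: datum speed `≤ (1−θ)Y₀`; cap
`≤ (1−θ)(5/3)Y₁` on the window; at `τ₁` inside `‖x‖ ≤ ρ₀`: speed `≥ (1+θ)Y₁`, gradient `≥ (1+θ)A₁`, and a `C¹` closed loop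
inside a `(1−θ)/N₁`-ball with parametrisation speed `≤ (1−θ)·8π/N₁` and reference circulation `≥ (1+θ)N₁^{β−2}`.
FEASIBLE SLACK RANGE: the speed face `(1+θ)Y₁ ≤ ‖wRef‖` and the cap `‖wRef‖ ≤ (1−θ)(5/3)Y₁` are jointly consistent only for
`θ ≤ 1/4`; the intended regime is `θ ≈ 0.03` (falsifier F1). [critic idea-crit-8 P3, 2026-08-28] -/
def ModelFaces (c : RingConfig) (θ : ℝ) : Prop :=
  (∀ x, ‖wRef c 1 x‖ ≤ (1 - θ) * Y0) ∧
  (∀ t ∈ Icc (1 : ℝ) τ1, ∀ x, ‖wRef c t x‖ ≤ (1 - θ) * (5 / 3 * Y1)) ∧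
  (∃ x, ‖x‖ ≤ c.ρ₀ ∧ (1 + θ) * Y1 ≤ ‖wRef c τ1 x‖) ∧
  (∃ x, ‖x‖ ≤ c.ρ₀ ∧ (1 + θ) * A1 ≤ ‖fderiv ℝ (wRef c τ1) x‖) ∧
  (∃ (x : EuclideanSpace ℝ (Fin 3)) (γ : ℝ → EuclideanSpace ℝ (Fin 3)),
      ‖x‖ ≤ c.ρ₀ ∧ ContDiff ℝ 1 γ ∧ γ 0 = γ 1 ∧
      (∀ σ ∈ Icc (0 : ℝ) 1, γ σ ∈ closedBall x ((1 - θ) / N1)) ∧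
      (∀ σ ∈ Icc (0 : ℝ) 1, ‖deriv γ σ‖ ≤ (1 - θ) * (8 * Real.pi / N1)) ∧
      (1 + θ) * N1 ^ (βt - 2) ≤ circulation (wRef c τ1) γ)

/-- ACCURACY OF THE REFERENCE [v4 budget]: `wRef` solves Navier–Stokes (`ν = 1`) classically on the tuned window up to a
smooth residual force `r` of sup size `≤ θ·Y₁·A₀/M₀` — a velocity-error budget `θ·Y₁` PER ENHANCED-DISSIPATION TIME `M₀/A₀`
(`M₀ = Re₀^{1/3} ≈ 9.19` level-`0` strain times), NOT per window. History: v1–v3 divided by the whole window length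
`τ₁ − 1 = L/A₀`, `L = 4bβ·log N₁ ≈ 169.85`; that asked a CLOSED-FORM Gaussian reference to be accurate to `θ/82 ≈ 0.04 %`
(θ = 0.03) of the natural acceleration scale `Y₀A₀`, below the `O((a/R)²) ≈ 0.25 %` residual that the unmodelled elliptic
deformation of a strained Gaussian core produces on its own — stub 1 was dead BY DESIGN and the decider job would have been a
foregone kill. The v4 budget (`θ = 0.05` ⇒ residual `≤ 1.1 %` of `Y₀A₀`) is above that floor, so the design question is real,
and the difference is moved to where it belongs — stub 2 must now cash SATURATION of the velocity error at the shear-diffusion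
scale (the residual injects `θ·Y₁` per time `M₀/A₀`, eighteen times over the window, yet the true solution is to stay within
`O(θ)·Y` of the reference uniformly): exactly Gallay–Šverák's mechanism and their conjecture «(nseapp) remains valid on longer
time scales of order T_adv·Re^{σ′}» (arXiv:2301.01092 p. 4). Two things this clause silently carries [critic idea-crit-8 P3]:
(i) `IsClassicalNSSolutionOn … (wRef c) …` forces the ring TRAJECTORIES `R_i, Z_i, a_i, s_i` to be smooth in `t` although
`RingConfig` has no regularity field — harmless under `∃ c` (the designer picks smooth trajectories), fatal for a non-smooth
`c`; (ii) how residual turns into velocity error is an ASSUMPTION that stub 2 (`ArnoldRingDoorT`) must CASH — it is exactly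
where the Rayleigh/centrifugal instability of compactly supported swirl on the outer flank of each core bites (exponential
growth over the window would make any budget meaningless); this is the line's front-page why-it-might-fail, not a footnote. -/
def ResidualSmall (c : RingConfig) (θ : ℝ) : Prop :=
  ∃ (r : ℝ → EuclideanSpace ℝ (Fin 3) → EuclideanSpace ℝ (Fin 3)) (pr : ℝ → EuclideanSpace ℝ (Fin 3) → ℝ),
    IsClassicalNSSolutionOn (Icc (1 : ℝ) τ1) 1 r (wRef c) pr ∧
    ∀ t ∈ Icc (1 : ℝ) τ1, ∀ x, ‖r t x‖ ≤ θ * Y1 * A0 / M0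

/-! ## §2 The two stubs and the composition -/

/-- **STUB 1 — THE SWIRLING RING DESIGN (finite-dimensional; the decider, run first).** Some explicit Gaussian-cored coaxial
ring configuration with swirl, in the thin-ring regime, meets the tuned door faces with relative slack `θ ∈ (0,1)` and
solves Navier–Stokes on the tuned window up to a residual of sup size `θ·Y₁·A₀/M₀` [v4]. Decidable by quadrature + a filament
ODE search (instrument: the N1 design-search MODEL tranche / the lane's axisymmetric engine with one extra scalar `u_θ`).
Why it might fail: the tuned register may pin the aspect ratio from below (ν = 1 over 169.85 strain times, speed face
`×2.07 > ×2` = the two-core superposition ceiling in the planar limit), leaving no Gaussian-ring superposition with a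
residual this small; sterile tranche-0 members reached 0.94 of the binding gradient face (swirl shear adds to `‖∇v‖`). -/
def SwirlRingDesignT : Prop :=
  ∃ θ : ℝ, 0 < θ ∧ θ < 1 ∧ ∃ c : RingConfig, Regime c ∧ ModelFaces c θ ∧ ResidualSmall c θ

/-- **STUB 2 — THE DOOR IN ARNOLD CURRENCY (uniform viscous coherence of thin coaxial swirling rings on the tuned window;
XL, research-grade: Gallay–Šverák arXiv:2301.01092 pp. 4, 6 leave exactly this open).** For every slack `θ > 0` and every
configuration in the regime meeting the reference faces with slack `θ` and the residual bound `θ·Y₁·A₀/M₀` [v4]: within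
`θ·Y₀/2` of the reference datum (sup norm) there is a smooth compactly supported divergence-free AXISYMMETRIC datum WITH
SWIRL, of speed `< Y₀`, whose free run (`ν = 1`, zero force) exists classically with finite energy on `[1, τ₁]`, stays
under the cap `(5/3)Y₁ − η` and shows the three tuned level-`1` faces with some margin `η > 0` inside its support ball —
verbatim the binders of `Theorems.palasekTowerBreakdown_episodeBaseT_of_mechanism_freeRun`. Why it might fail:
compactly supported swirl is Rayleigh-unstable on the outer flank of each core (centrifugal growth over 169.85 strain
times may beat any residual budget); the error must SATURATE at the shear-diffusion scale `M₀/A₀` although the residual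
injects `θ·Y₁` per such time ≈ 18 times over the window (v4: this is the Gallay–Šverák `T_adv·Re^{σ′}` conjecture, p. 4,
in the multi-ring swirling setting); strain-enhanced diffusion near fast cores (the authors' own caveat, p. 6). -/
def ArnoldRingDoorT : Prop :=
  ∀ θ : ℝ, 0 < θ → ∀ c : RingConfig, Regime c → ModelFaces c θ → ResidualSmall c θ →
    ∃ (W : EuclideanSpace ℝ (Fin 3) → EuclideanSpace ℝ (Fin 3)) (ρ : ℝ)
      (v : ℝ → EuclideanSpace ℝ (Fin 3) → EuclideanSpace ℝ (Fin 3)) (q : ℝ → EuclideanSpace ℝ (Fin 3) → ℝ) (η : ℝ),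
      IsAxisymmetric W ∧ ¬ HasNoSwirl W ∧ (∀ x, ‖W x - wRef c 1 x‖ ≤ θ / 2 * Y0) ∧
      ContDiff ℝ ∞ W ∧ VectorCalculus.IsDivFree W ∧ tsupport W ⊆ closedBall 0 ρ ∧
      (∀ x, ‖W x‖ < TowerRates.tuned.Y 0) ∧ 0 ≤ ρ ∧
      IsClassicalNSSolutionOn (Icc 1 (Host.τfirstAt TowerRates.tuned)) 1 0 v q ∧ v 1 = W ∧
      (∃ C : ℝ≥0∞, C < ⊤ ∧ ∀ t ∈ Icc (1 : ℝ) (Host.τfirstAt TowerRates.tuned), ∫⁻ x, ‖v t x‖ₑ ^ 2 ≤ C) ∧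
      0 < η ∧
      (∀ t ∈ Icc (1 : ℝ) (Host.τfirstAt TowerRates.tuned), ∀ x, ‖v t x‖ ≤ 5 / 3 * TowerRates.tuned.Y 1 - η) ∧
      (∃ x, ‖x‖ ≤ ρ ∧ TowerRates.tuned.Y 1 + η ≤ ‖v (Host.τfirstAt TowerRates.tuned) x‖) ∧
      (∃ x, ‖x‖ ≤ ρ ∧ TowerRates.tuned.A 1 + η ≤ ‖fderiv ℝ (v (Host.τfirstAt TowerRates.tuned)) x‖) ∧
      (∃ (x : EuclideanSpace ℝ (Fin 3)) (γ : ℝ → EuclideanSpace ℝ (Fin 3)),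
        ‖x‖ ≤ ρ ∧ ContDiff ℝ 1 γ ∧ γ 0 = γ 1 ∧
        (∀ s ∈ Icc (0 : ℝ) 1, γ s ∈ closedBall x (1 / TowerRates.tuned.N 1)) ∧
        (∀ s ∈ Icc (0 : ℝ) 1, ‖deriv γ s‖ ≤ 8 * Real.pi / TowerRates.tuned.N 1) ∧
        TowerRates.tuned.N 1 ^ (TowerRates.tuned.β - 2) + η ≤
          circulation (v (Host.τfirstAt TowerRates.tuned)) γ)

/-- Registered stub 1 (design; finite-dimensional). -/
theorem stub_swirl_ring_designT : SwirlRingDesignT := by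
  sorry

/-- Registered stub 2 (the Arnold-currency door; analysis). -/
theorem stub_arnold_ring_doorT : ArnoldRingDoorT := by
  sorry

/-- **THE CRUX OF RECORD FROM THE TWO REGISTERED STUBS (sorry-free composition; what `ledger skeleton check` audits):
design ⊕ door ⟹ `EpisodeBaseT` BY NAME**, through the landed binder-form door
`Theorems.palasekTowerBreakdown_episodeBaseT_of_mechanism_freeRun` (symmetry, swirl and closeness are unused for 20303 itself —
they pin the WITNESS CLASS outside the sterile stratum of K201).  RECORD [critic idea-crit-8 P4]: since the composition
DISCARDS axisymmetry / swirl / closeness, for 20303 as typed this line is «a design near which SOME true run meets the door»;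
the extra structure is only what makes stub 2 a theorem-shaped (Gallay–Šverák-type) statement instead of the kernel
certificate again — a proof attempt on stub 2 may freely change the witness class, and «Arnold currency» is the line's
framing of stub 2, not something the crux needs. [cite: Palasek2026ElementaryModel, §4] -/
theorem episodeBaseT_from_line : PalasekTowerBreakdown.EpisodeBaseT := by
  obtain ⟨θ, hθ, -, c, hR, hF, hres⟩ := stub_swirl_ring_designT
  obtain ⟨W, ρ, v, q, η, -, -, -, hW, hdiv, hsupp, hlt, hρ, hv, hv1, hE, hη, hcap, hspeed, hstrain, hcore⟩ :=
    stub_arnold_ring_doorT θ hθ c hR hF hres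
  exact Theorems.palasekTowerBreakdown_episodeBaseT_of_mechanism_freeRun hW hdiv hsupp hlt hρ hv hv1 hE hη hcap hspeed
    hstrain hcore

end Summit.NavierStokesRegularity.NavierStokesRegularity.Cruxes.EpisodeBaseT.ArnoldRingDoor

end
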